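import Summits.QuantumFields.YangMills.Theorems.UnitScaleTiltHalvingP1FlatPillar
import HarnessLib

/-!
# Route `UnitScaleTilt`, crux K1 child «MinimiserStabilityRegPr» (stmt-QuantumFields-19200), registered stub V2′ `stub_halvingStep`
# (skeletons v8 5b4e846794b80374 ∕ v10 `BirthV10`) — **THE PACKAGE ROWS SERVED BY PILLAR P1♭ FROM THE TEXT OF RECORD `P1FlatPillarAt`** (owner RULING g26-№18 (D):
# «then ★w7 files v1.2 `package_rows_of_P1FlatPillarAt` importing it»; v1.2 of ✓ `HalvingChartP1Display` as a SEPARATE file — the pillar's defs file imports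
# `…HalvingChartP1Display`, so an append there would close an import cycle)

Cell `ym3-torus` (HUMAN RULING D-0037, YM ladder rung R3 — continuum SU(2) YM₃ on the torus is a RUNG, not the Clay problem), width seat
`ym-ust-19200-w7` gen 0 (D-0154 (3c)).  `--supports stmt-QuantumFields-19200 --as helper`; def-free, 0 sorry, standard axioms.

WHAT THIS FILE PROVES (no definition, no sorry): ★★ **`package_rows_of_P1FlatPillarAt`** — from the pillar text of record `HalvingP1FlatPillar.P1FlatPillarAt F n K (cubeSeqMT3 …) x ε₀ ε₁ B₁ C₁ C₂ U`
(★w3-19200 g4, `Theorems/UnitScaleTiltHalvingP1FlatPillar.lean`), the level weights `w`, the rows of `H`∕`C` (`hH hH' hCq hCtr`, as in ✓ `package_rows_of_P1disp_su2`) and `B₁ε₀ < R`: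
gauge map `u` and Thm-2 field `A` with — the package's (P1-chart) clause on the one-point layer at `x`; `A′ := A + H(C A)` bondwise TRACELESS; hypothesis (ii) (slice) and (iv)
(both (152) letters at `δ = δ′ = B₁ε₀`) of ✓ `HalvingA1Row165TraceSU2.row165_of_tracePairing_L5_su2` for `A′`; the (160)♭ near row in the `hnear` currency of
`HalvingAssemblyInterior.H_of_packageInt` over the bare `chartLogFlat` (S19; the step `Q_{K−n}A′(c) = chartLogFlat η D A c` on interior top bonds is the census junction
`bondAvgIter_top_chartPreimage`, not here); and the designed clause `DP1Clause` (D-P1, RULING №16 (5)) — by `HalvingP1FlatPillar.hP1_of_P1FlatPillarAt` ∘ `package_rows_of_P1disp_su2`.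
HONEST SCOPE.  Bookkeeping; the pillar (XL) is the hypothesis.  NOT a claim about the stub, the crux, the rung or the mass gap.

References: T. Bałaban, CMP **99** (1985) 75–102 [Balaban1985RegularSpaces] Thm 2 p.83, (1.36)–(1.38) p.82; CMP **102** (1985) 277–309 [Balaban1985Variational] (152)–(156)
pp.301–302, (160) p.303, (165) p.304.
-/

set_option autoImplicit false

noncomputable section

open scoped BigOperators InnerProductSpace Matrix Matrix.Norms.L2Operator

namespace Summit.QuantumFields.YangMills.Theorems.HalvingChartP1FlatRows

open Literature.MathematicalPhysics.QuantumFieldTheory.Balaban1983to89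
open Literature.MathematicalPhysics.QuantumFieldTheory.Balaban1983to89.T3UnitLawDensityEML (ℰp)
open Complex (I)
open B5Eq117TorusCarriers (Mk)
open B5Eq118OneStroke (iterBlockOf)
open B5Prop12FieldsLattice (distSite)
open B6SectADomainsV1 (Domains)
open B6SectAOperatorsV1 (BondIdx SiteIdx RE dsE)
open B7Prop1Explicit (expUnit)
open B8Eq140Level (SideTouches)
open B8Thm2SetupTorus (pullDom)
open B10Eq27TorusAxialLog (transl unitsField toUField)
open LatticeFieldCalculus (laplace diverg siteAvgIter)
open T3ContinuumYM3Torus (T3Family)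
open FlatCubeOpsText (IsLevWeight)
open FlatOpsLettersAssembly (flatH)
open FlatCubeSequenceAligned (cubeSeqMT3)
open Summit.QuantumFields.YangMills.Theorems.Prop8ChartDoubleBar (chartLogFlat)
open HalvingChartP1Display (package_rows_of_P1disp_su2)
open HalvingP1FlatPillar (P1FlatPillarAt DP1Clause hP1_of_P1FlatPillarAt)

variable {F : T3Family} {n K : ℕ}

/-- ★★ **THE PACKAGE ROWS SERVED BY PILLAR P1♭, FROM ITS TEXT OF RECORD** — see the module docstring.
[cite: Balaban1985RegularSpaces, Thm 2 p.83, (1.36)-(1.38) p.82; Balaban1985Variational, (152)-(156) pp.301-302, (160) p.303, (165) p.304] -/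
theorem package_rows_of_P1FlatPillarAt (hnK : n < K) (x : Site (F.P K) 0) (ρ S M : ℕ) (hM : 1 ≤ M) {ε₀ ε₁ B₁ C₁ C₂ : ℝ}
    {U : GaugeField (F.P K) 0 (Matrix.specialUnitaryGroup (Fin 2) ℂ)}
    (hP1 : P1FlatPillarAt F n K (cubeSeqMT3 F n K x ρ S M hM) x ε₀ ε₁ B₁ C₁ C₂ U)
    {w : ℕ → PBond (F.P K) 0 → ℝ} (hw : IsLevWeight F n K (cubeSeqMT3 F n K x ρ S M hM) w)
    (C : (PBond (F.P K) 0 → Matrix (Fin 2) (Fin 2) ℂ) → (BondIdx (cubeSeqMT3 F n K x ρ S M hM) → Matrix (Fin 2) (Fin 2) ℂ)) {B_H B_H' C₂' R : ℝ}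
    (hH : ∀ (X : BondIdx (cubeSeqMT3 F n K x ρ S M hM) → Matrix (Fin 2) (Fin 2) ℂ) (t : ℝ), (∀ i, ‖X i‖ ≤ t) →
      ∀ b, w 1 b * ‖∑ c, flatH F n K (cubeSeqMT3 F n K x ρ S M hM) (Pi.single c 1) b • X c‖ ≤ B_H * t)
    (hH' : ∀ (X : BondIdx (cubeSeqMT3 F n K x ρ S M hM) → Matrix (Fin 2) (Fin 2) ℂ) (t : ℝ), (∀ i, ‖X i‖ ≤ t) →
      ∀ (b : PBond (F.P K) 0) (ν : Fin (F.P K).d),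
        w 2 b * (F.L : ℝ) ^ (K - n) *
          ‖(∑ c, flatH F n K (cubeSeqMT3 F n K x ρ S M hM) (Pi.single c 1) ⟨b.src.shift ν, b.dir⟩ • X c) -
            ∑ c, flatH F n K (cubeSeqMT3 F n K x ρ S M hM) (Pi.single c 1) b • X c‖ ≤ B_H' * t)
    (hCq : ∀ (Y : PBond (F.P K) 0 → Matrix (Fin 2) (Fin 2) ℂ) (r : ℝ), r < R → (∀ b, w 1 b * ‖Y b‖ ≤ r) → ∀ i, ‖C Y i‖ ≤ C₂' * r ^ 2)
    (hCtr : ∀ (Y : PBond (F.P K) 0 → Matrix (Fin 2) (Fin 2) ℂ), (∀ b, Matrix.trace (Y b) = 0) → ∀ i, Matrix.trace (C Y i) = 0)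
    (hδR : B₁ * ε₀ < R) :
    ∃ (u : GaugeTransf (F.P K) 0 (Matrix.unitaryGroup (Fin 2) ℂ)) (A : PBond (F.P K) 0 → Matrix (Fin 2) (Fin 2) ℂ),
      ((∀ b : PBond (F.P K) 0, IsSelfAdjoint (A b)) ∧
        (∀ (z : B7Prop1Explicit.Site (F.P K).d) (μ : Fin (F.P K).d),
          SideTouches (pullDom (fun j => if K - n ≤ j then ({x} : Set (Site (F.P K) 0)) else (∅ : Set (Site (F.P K) 0))) (K - n)) z μ →
          (Unitary.toUnits (u (transl 0 z)))⁻¹ * unitsField (toUField U) ⟨transl 0 z, μ⟩ * Unitary.toUnits (u ((transl 0 z).shift μ)) =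
            expUnit (I • ((((F.L : ℝ)⁻¹) ^ (K - n)) • A ⟨transl 0 z, μ⟩)))) ∧
      (∀ b, Matrix.trace ((A + fun b => ∑ c, flatH F n K (cubeSeqMT3 F n K x ρ S M hM) (Pi.single c 1) b • C A c) b) = 0) ∧
      (∀ φ : Matrix (Fin 2) (Fin 2) ℂ →ₗ[ℝ] ℝ,
        RE (cubeSeqMT3 F n K x ρ S M hM) ((F.L : ℝ) ^ (K - n)) (dsE ((F.L : ℝ) ^ (K - n))
          (WithLp.toLp 2 (fun b => φ ((A + fun b => ∑ c, flatH F n K (cubeSeqMT3 F n K x ρ S M hM) (Pi.single c 1) b • C A c) b)))) = 0) ∧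
      (∀ b, w 1 b * ‖(A + fun b => ∑ c, flatH F n K (cubeSeqMT3 F n K x ρ S M hM) (Pi.single c 1) b • C A c) b‖ ≤ B₁ * ε₀ + B_H * (C₂' * (B₁ * ε₀) ^ 2)) ∧
      (∀ (b : PBond (F.P K) 0) (ν : Fin (F.P K).d),
        w 2 b * (F.L : ℝ) ^ (K - n) *
          ‖(A + fun b => ∑ c, flatH F n K (cubeSeqMT3 F n K x ρ S M hM) (Pi.single c 1) b • C A c) ⟨b.src.shift ν, b.dir⟩ -
            (A + fun b => ∑ c, flatH F n K (cubeSeqMT3 F n K x ρ S M hM) (Pi.single c 1) b • C A c) b‖ ≤ B₁ * ε₀ + B_H' * (C₂' * (B₁ * ε₀) ^ 2)) ∧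
      (∀ c : BondIdx (cubeSeqMT3 F n K x ρ S M hM), (c.1.1 : ℕ) = K - n →
        c.1.2.src ∈ (cubeSeqMT3 F n K x ρ S M hM).Om (c.1.1 : ℕ) → c.1.2.tgt ∈ (cubeSeqMT3 F n K x ρ S M hM).Om (c.1.1 : ℕ) →
        ‖chartLogFlat (((F.L : ℝ)⁻¹) ^ (K - n)) (cubeSeqMT3 F n K x ρ S M hM) A c‖ ≤
          C₁ * ε₁ * (distSite (Mk (F.P K) (c.1.1 : ℕ)) c.1.2.src (iterBlockOf (c.1.1 : ℕ) x) + 1)) ∧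
      DP1Clause F n K (cubeSeqMT3 F n K x ρ S M hM) x U u := by
  obtain ⟨u, A, h6, hnear, hdp1⟩ := hP1_of_P1FlatPillarAt F n K hnK x ρ S M hM hP1 hw
  obtain ⟨h0, htr, hii, h1, h2⟩ := package_rows_of_P1disp_su2 x ρ S M hM hw C hH hH' hCq hCtr hδR U h6
  exact ⟨u, A, h0, htr, hii, h1, h2, hnear, hdp1⟩

end Summit.QuantumFields.YangMills.Theorems.HalvingChartP1FlatRows

end
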